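import Mathlib.LinearAlgebra.BilinearForm.Orthogonal
import Mathlib.LinearAlgebra.Reflection
import Mathlib.LinearAlgebra.Matrix.SchurComplement
import Mathlib.LinearAlgebra.Matrix.ToLin
import Mathlib.LinearAlgebra.Determinant
import Mathlib.Algebra.Group.Submonoid.Membership
import HarnessLib

/-!
# Orthogonal groups are generated by reflections (weak Cartan–Dieudonné) and `det` of a reflection (Zarhin's theorem, step 9a)

Pure linear algebra over a field `K` of characteristic `0`. For a symmetric bilinear form `B` on a
finite-dimensional `V` and an anisotropic `u` (`B(u,u) ≠ 0`) the **reflection**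
`s_u : y ↦ y - (2 B(u,y)/B(u,u)) u` is Mathlib's `Module.reflection` for the functional
`(2/B(u,u)) B(u, ·)` (`reflCoeff_apply_self`). We prove:

* `s_u` is a `B`-isometry (`form_reflection_reflection`), fixes `u^⊥` pointwise, and has
  determinant `-1` (`det_reflection_eq_neg_one`, matrix determinant lemma);
* **weak Cartan–Dieudonné theorem, relative form** (`mem_closure_reflections`): if `B` is
  non-degenerate, `W ⊆ V` is a subspace with `W ∩ W^⊥ = 0`, and `g` is a `B`-isometry of `V`
  acting trivially on `W^⊥`, then `g` lies in the monoid generated by the reflections `s_u`,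
  `u ∈ W` anisotropic. (E. Artin, *Geometric Algebra*, Thm. 3.20; J. Dieudonné, *Sur les groupes
  classiques*; here the classical induction on `dim W`: move `g w` back to an anisotropic
  `w ∈ W` by one or two reflections, then descend to `W ∩ w^⊥`.)

This is used in the tree's proof of Zarhin's theorem on the Hodge group of a K3-type Hodge
structure (Huybrechts, *Lectures on K3 Surfaces*, Thm. 3.3.9) to pass from the Lie algebra
statement `Lie(Hdg)_ℂ ⊇ so(T_σ)` to the group statement on `SO(T_σ)`: an element of `SO` is a
product of an EVEN number of reflections, i.e. of plane rotations. No definitions, no named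
facts.

## References

* E. Artin, *Geometric Algebra* (Interscience 1957), Ch. III, Thm. 3.20 (Cartan–Dieudonné).
* D. Huybrechts, *Lectures on K3 Surfaces* (CUP 2016), Ch. 3, Thm. 3.3.9.
-/

noncomputable section

namespace Literature.AlgebraicGeometry.Motives

namespace ZarhinLie

universe u v

variable {K : Type u} [Field K] {V : Type v} [AddCommGroup V] [Module K V]
  (B : LinearMap.BilinForm K V)

/-! ### Reflections along anisotropic vectors -/

/-- The reflection functional `(2 / B(u,u)) B(u, ·)` takes the value `2` at `u`. [folklore] -/
theorem reflCoeff_apply_self {u : V} (hu : B u u ≠ 0) : ((2 / B u u) • B u) u = 2 := by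
  rw [LinearMap.smul_apply, smul_eq_mul, div_mul_cancel₀ _ hu]

/-- The reflection along `u`: `s_u y = y - (2 B(u,y) / B(u,u)) u`. [folklore] -/
theorem reflection_apply' {u : V} (hu : B u u ≠ 0) (y : V) :
    Module.reflection (reflCoeff_apply_self B hu) y = y - (2 / B u u * B u y) • u := by
  rw [Module.reflection_apply, LinearMap.smul_apply, smul_eq_mul]

/-- A reflection fixes the vectors orthogonal to `u`. [folklore] -/
theorem reflection_apply_of_orth {u : V} (hu : B u u ≠ 0) {m : V} (hm : B u m = 0) :
    Module.reflection (reflCoeff_apply_self B hu) m = m := by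
  rw [reflection_apply' B hu, hm, mul_zero, zero_smul, sub_zero]

/-- **Reflections are isometries** (for symmetric `B`). [folklore] -/
theorem form_reflection_reflection (hB : ∀ x y, B x y = B y x) {u : V} (hu : B u u ≠ 0)
    (y z : V) :
    B (Module.reflection (reflCoeff_apply_self B hu) y)
      (Module.reflection (reflCoeff_apply_self B hu) z) = B y z := by
  rw [reflection_apply' B hu, reflection_apply' B hu]
  simp only [map_sub, map_smul, LinearMap.sub_apply, LinearMap.smul_apply, smul_eq_mul,
    hB y u]
  field_simp
  ring

/-- A reflection is an involution: `s_u (s_u y) = y`. [folklore] -/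
theorem reflection_reflection {u : V} (hu : B u u ≠ 0) (y : V) :
    Module.reflection (reflCoeff_apply_self B hu) (Module.reflection (reflCoeff_apply_self B hu) y) = y :=
  Module.involutive_reflection _ y

/-- As a group element, a reflection is its own inverse. [folklore] -/
theorem reflection_mul_self {u : V} (hu : B u u ≠ 0) :
    Module.reflection (reflCoeff_apply_self B hu) * Module.reflection (reflCoeff_apply_self B hu) = 1 := by
  ext y
  exact reflection_reflection B hu y

/-- **`s_{w-v}` maps `v` to `w`** when `B(v,v) = B(w,w)` and `w - v` is anisotropic. [folklore] -/
theorem reflection_sub_apply [CharZero K] (hB : ∀ x y, B x y = B y x) {v w : V} (hvw : B v v = B w w)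
    (h : B (w - v) (w - v) ≠ 0) : Module.reflection (reflCoeff_apply_self B h) v = w := by
  rw [reflection_apply' B h]
  have h1 : B (w - v) (w - v) = 2 * (B w w - B w v) := by
    simp only [map_sub, LinearMap.sub_apply, hB v w, hvw]; ring
  have h2 : B (w - v) v = -(B w w - B w v) := by
    simp only [map_sub, LinearMap.sub_apply, hvw]; ring
  have h3 : B w w - B w v ≠ 0 := fun h0 => h (by rw [h1, h0, mul_zero])
  rw [h1, h2, show (2 / (2 * (B w w - B w v)) * -(B w w - B w v)) = -1 by field_simp]
  simp [neg_smul, one_smul]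

/-- **`s_{w+v}` maps `v` to `-w`** when `B(v,v) = B(w,w)` and `w + v` is anisotropic. [folklore] -/
theorem reflection_add_apply [CharZero K] (hB : ∀ x y, B x y = B y x) {v w : V} (hvw : B v v = B w w)
    (h : B (w + v) (w + v) ≠ 0) : Module.reflection (reflCoeff_apply_self B h) v = -w := by
  rw [reflection_apply' B h]
  have h1 : B (w + v) (w + v) = 2 * (B w w + B w v) := by
    simp only [map_add, LinearMap.add_apply, hB v w, hvw]; ring
  have h2 : B (w + v) v = B w w + B w v := by
    simp only [map_add, LinearMap.add_apply, hvw]; ring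
  have h3 : B w w + B w v ≠ 0 := fun h0 => h (by rw [h1, h0, mul_zero])
  rw [h1, h2, show (2 / (2 * (B w w + B w v)) * (B w w + B w v)) = 1 by field_simp, one_smul]
  abel

/-- One of `w - v`, `w + v` is anisotropic when `w` is and `B(v,v) = B(w,w)` (characteristic `0`):
`B(w-v,w-v) + B(w+v,w+v) = 4 B(w,w)`. [folklore] -/
theorem sub_aniso_or_add_aniso [CharZero K] {v w : V} (hvw : B v v = B w w) (hw : B w w ≠ 0) :
    B (w - v) (w - v) ≠ 0 ∨ B (w + v) (w + v) ≠ 0 := by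
  by_contra h
  push Not at h
  have hsum : B (w - v) (w - v) + B (w + v) (w + v) = 4 * B w w := by
    simp only [map_sub, map_add, LinearMap.sub_apply, LinearMap.add_apply, hvw]; ring
  rw [h.1, h.2, add_zero] at hsum
  exact hw (by
    have : (4 : K) ≠ 0 := by norm_num
    exact (mul_eq_zero.1 hsum.symm).resolve_left this)

/-- A subspace meeting its orthogonal trivially and on which `B` is not identically isotropic...
precisely: **a non-zero subspace `W` with `W ∩ W^⊥ = 0` contains an anisotropic vector**
(characteristic `0`: otherwise `B|_W = 0` by polarization). [folklore] -/
theorem exists_aniso_of_ne_bot [CharZero K] (hB : ∀ x y, B x y = B y x) {W : Submodule K V}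
    (hW : Disjoint W (B.orthogonal W)) (hW0 : W ≠ ⊥) : ∃ w ∈ W, B w w ≠ 0 := by
  by_contra h
  push Not at h
  have hpol : ∀ x ∈ W, ∀ y ∈ W, B x y = 0 := by
    intro x hx y hy
    have h1 := h (x + y) (W.add_mem hx hy)
    simp only [map_add, LinearMap.add_apply, h x hx, h y hy, hB y x, zero_add, add_zero] at h1
    have h2 : (2 : K) * B x y = 0 := by rw [two_mul]; exact h1
    exact (mul_eq_zero.1 h2).resolve_left two_ne_zero
  apply hW0
  rw [eq_bot_iff]
  intro x hx
  have hx' : x ∈ B.orthogonal W := by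
    rw [LinearMap.BilinForm.mem_orthogonal_iff]
    intro n hn
    exact hpol n hn x hx
  exact hW.le_bot ⟨hx, hx'⟩

/-- **An isometry acting trivially on `W^⊥` preserves `W`** (`B` non-degenerate and symmetric,
`V` finite-dimensional: `W = W^⊥⊥`). [folklore] -/
theorem apply_mem_of_forall_orthogonal [FiniteDimensional K V] (hB : ∀ x y, B x y = B y x)
    (hBnd : B.Nondegenerate) {W : Submodule K V} {g : V ≃ₗ[K] V}
    (hg : ∀ x y, B (g x) (g y) = B x y) (hgW : ∀ m ∈ B.orthogonal W, g m = m) {x : V}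
    (hx : x ∈ W) : g x ∈ W := by
  have hrefl : B.IsRefl := fun x y h => by rw [hB]; exact h
  rw [← LinearMap.BilinForm.orthogonal_orthogonal hBnd hrefl W, LinearMap.BilinForm.mem_orthogonal_iff]
  intro m hm
  change B m (g x) = 0
  rw [← hgW m hm, hg, hB]
  exact (LinearMap.BilinForm.mem_orthogonal_iff.1 hm) x hx

/-! ### Weak Cartan–Dieudonné -/

/-- **Weak Cartan–Dieudonné theorem (relative form).** Let `B` be a non-degenerate symmetric
bilinear form on a finite-dimensional `V` over a field of characteristic `0`, `W` a subspace with
`W ∩ W^⊥ = 0`, and `g` a `B`-isometry of `V` acting trivially on `W^⊥`. Then `g` belongs to the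
monoid generated by the reflections along anisotropic vectors of `W` (E. Artin, *Geometric
Algebra*, Thm. 3.20, in the weak form "generated by reflections"; induction on `dim W`).
[folklore] -/
theorem mem_closure_reflections [FiniteDimensional K V] [CharZero K] (hB : ∀ x y, B x y = B y x)
    (hBnd : B.Nondegenerate) :
    ∀ (W : Submodule K V), Disjoint W (B.orthogonal W) → ∀ g : V ≃ₗ[K] V,
      (∀ x y, B (g x) (g y) = B x y) → (∀ m ∈ B.orthogonal W, g m = m) →
      g ∈ Submonoid.closure {r : V ≃ₗ[K] V | ∃ (u : V) (hu : B u u ≠ 0), u ∈ W ∧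
        r = Module.reflection (reflCoeff_apply_self B hu)} := by
  have hrefl : B.IsRefl := fun x y h => by rw [hB]; exact h
  intro W
  induction hd : Module.finrank K W using Nat.strong_induction_on generalizing W with
  | _ d ih =>
  intro hW g hg hgW
  set R : Set (V ≃ₗ[K] V) := {r | ∃ (u : V) (hu : B u u ≠ 0), u ∈ W ∧
    r = Module.reflection (reflCoeff_apply_self B hu)} with hR
  by_cases hW0 : W = ⊥
  · -- `W = 0`: `g` is the identity
    subst hW0
    have hg1 : g = 1 := by
      ext x
      exact hgW x (by rw [LinearMap.BilinForm.orthogonal_bot]; exact Submodule.mem_top)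
    rw [hg1]
    exact Submonoid.one_mem _
  -- an anisotropic `w ∈ W` and `v = g w ∈ W`
  obtain ⟨w, hwW, hw⟩ := exists_aniso_of_ne_bot B hB hW hW0
  set v := g w with hv
  have hvW : v ∈ W := apply_mem_of_forall_orthogonal B hB hBnd hg hgW hwW
  have hvw : B v v = B w w := hg w w
  -- reflections along vectors of `W` fix `W^⊥` pointwise and are isometries preserving `W`
  have hRprop : ∀ (u : V) (hu : B u u ≠ 0), u ∈ W →
      (∀ m ∈ B.orthogonal W, Module.reflection (reflCoeff_apply_self B hu) m = m) := by
    intro u hu huW m hm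
    exact reflection_apply_of_orth B hu ((LinearMap.BilinForm.mem_orthogonal_iff.1 hm) u huW)
  -- `r ∈ closure R` with `r v = w`, `r` an isometry fixing `W^⊥`, with inverse in the closure
  obtain ⟨r, hrmem, hrinv, hrv, hriso, hrW⟩ : ∃ r : V ≃ₗ[K] V, r ∈ Submonoid.closure R ∧
      (∃ r' ∈ Submonoid.closure R, r' * r = 1) ∧ r v = w ∧ (∀ x y, B (r x) (r y) = B x y) ∧
      (∀ m ∈ B.orthogonal W, r m = m) := by
    rcases sub_aniso_or_add_aniso B hvw hw with h | h
    · refine ⟨Module.reflection (reflCoeff_apply_self B h), Submonoid.subset_closure ?_, ?_,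
        reflection_sub_apply B hB hvw h, form_reflection_reflection B hB h, ?_⟩
      · exact ⟨w - v, h, W.sub_mem hwW hvW, rfl⟩
      · exact ⟨_, Submonoid.subset_closure ⟨w - v, h, W.sub_mem hwW hvW, rfl⟩,
          reflection_mul_self B h⟩
      · exact hRprop _ h (W.sub_mem hwW hvW)
    · refine ⟨Module.reflection (reflCoeff_apply_self B hw) *
          Module.reflection (reflCoeff_apply_self B h), ?_, ?_, ?_, ?_, ?_⟩
      · exact Submonoid.mul_mem _ (Submonoid.subset_closure ⟨w, hw, hwW, rfl⟩)
          (Submonoid.subset_closure ⟨w + v, h, W.add_mem hwW hvW, rfl⟩)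
      · refine ⟨Module.reflection (reflCoeff_apply_self B h) *
          Module.reflection (reflCoeff_apply_self B hw), Submonoid.mul_mem _
            (Submonoid.subset_closure ⟨w + v, h, W.add_mem hwW hvW, rfl⟩)
            (Submonoid.subset_closure ⟨w, hw, hwW, rfl⟩), ?_⟩
        rw [mul_assoc, ← mul_assoc (Module.reflection (reflCoeff_apply_self B hw)),
          reflection_mul_self B hw, one_mul, reflection_mul_self B h]
      · rw [LinearEquiv.mul_apply, reflection_add_apply B hB hvw h, map_neg,
          Module.reflection_apply_self, neg_neg]
      · intro x y
        rw [LinearEquiv.mul_apply, LinearEquiv.mul_apply, form_reflection_reflection B hB hw,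
          form_reflection_reflection B hB h]
      · intro m hm
        rw [LinearEquiv.mul_apply, hRprop _ h (W.add_mem hwW hvW) m hm, hRprop _ hw hwW m hm]
  -- `g' = r g` fixes `w` and `W^⊥`
  set g' := r * g with hg'
  have hg'w : g' w = w := by rw [hg', LinearEquiv.mul_apply, ← hv, hrv]
  have hg'iso : ∀ x y, B (g' x) (g' y) = B x y := fun x y => by
    rw [hg', LinearEquiv.mul_apply, LinearEquiv.mul_apply, hriso, hg]
  have hg'W : ∀ m ∈ B.orthogonal W, g' m = m := fun m hm => by
    rw [hg', LinearEquiv.mul_apply, hgW m hm, hrW m hm]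
  -- the smaller subspace `W' = W ∩ w^⊥`
  set W' : Submodule K V := W ⊓ B.orthogonal (K ∙ w) with hW'
  have hW'W : W' ≤ W := inf_le_left
  have hwW' : w ∉ W' := fun h => hw ((LinearMap.BilinForm.mem_orthogonal_iff.1 h.2) w
    (Submodule.mem_span_singleton_self w))
  have hlt : Module.finrank K W' < d := by
    rw [← hd]
    exact Submodule.finrank_lt_finrank_of_lt (lt_of_le_of_ne hW'W fun h => hwW' (h ▸ hwW))
  have hmemW' : ∀ x, x ∈ W' ↔ x ∈ W ∧ B w x = 0 := by
    intro x
    rw [hW', Submodule.mem_inf, LinearMap.BilinForm.mem_orthogonal_iff]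
    constructor
    · exact fun ⟨h1, h2⟩ => ⟨h1, h2 w (Submodule.mem_span_singleton_self w)⟩
    · rintro ⟨h1, h2⟩
      refine ⟨h1, fun n hn => ?_⟩
      obtain ⟨c, rfl⟩ := Submodule.mem_span_singleton.1 hn
      change B (c • w) x = 0
      rw [map_smul, LinearMap.smul_apply, h2, smul_zero]
  -- decomposition `n = (B w n / B w w) w + n'` with `n' ∈ W'`, for `n ∈ W`
  have hdec : ∀ n ∈ W, n - (B w n / B w w) • w ∈ W' := by
    intro n hn
    rw [hmemW']
    refine ⟨W.sub_mem hn (W.smul_mem _ hwW), ?_⟩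
    rw [map_sub, map_smul, smul_eq_mul, div_mul_cancel₀ _ hw, sub_self]
  -- `W' ∩ W'^⊥ = 0`
  have hW'disj : Disjoint W' (B.orthogonal W') := by
    rw [Submodule.disjoint_def]
    intro x hx hxo
    have hxW : x ∈ W := hW'W hx
    have hxo' : x ∈ B.orthogonal W := by
      rw [LinearMap.BilinForm.mem_orthogonal_iff]
      intro n hn
      change B n x = 0
      have h1 : B (n - (B w n / B w w) • w) x = 0 :=
        (LinearMap.BilinForm.mem_orthogonal_iff.1 hxo) _ (hdec n hn)
      have h2 : B w x = 0 := ((hmemW' x).1 hx).2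
      rw [map_sub, map_smul, LinearMap.sub_apply, LinearMap.smul_apply, h2, smul_zero,
        sub_zero] at h1
      exact h1
    exact (Submodule.mem_bot K).1 (hW.le_bot ⟨hxW, hxo'⟩)
  -- `g'` acts trivially on `W'^⊥`
  have hcompl : IsCompl W (B.orthogonal W) :=
    LinearMap.BilinForm.isCompl_orthogonal_of_restrict_nondegenerate hrefl
      (B.nondegenerate_restrict_of_disjoint_orthogonal hrefl hW)
  have hg'W' : ∀ m ∈ B.orthogonal W', g' m = m := by
    intro m hm
    obtain ⟨m₁, hm₁, m₂, hm₂, rfl⟩ := Submodule.mem_sup.1 (hcompl.sup_eq_top ▸ Submodule.mem_top :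
      m ∈ W ⊔ B.orthogonal W)
    rw [map_add, hg'W m₂ hm₂]
    congr 1
    -- `m₁ ∈ W ∩ W'^⊥`; write `m₁ = c w + m₁'` with `m₁' ∈ W' ∩ W'^⊥ = 0`
    have hm₁o : m₁ ∈ B.orthogonal W' := by
      rw [LinearMap.BilinForm.mem_orthogonal_iff] at hm ⊢
      intro n hn
      have h1 := hm n hn
      have h2 : B n m₂ = 0 := (LinearMap.BilinForm.mem_orthogonal_iff.1 hm₂) n (hW'W hn)
      change B n (m₁ + m₂) = 0 at h1
      change B n m₁ = 0
      rwa [map_add, h2, add_zero] at h1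
    have hm₁' : m₁ - (B w m₁ / B w w) • w = 0 := by
      refine (Submodule.mem_bot K).1 (hW'disj.le_bot (Submodule.mem_inf.2 ⟨hdec m₁ hm₁, ?_⟩))
      rw [LinearMap.BilinForm.mem_orthogonal_iff]
      intro n hn
      change B n (m₁ - (B w m₁ / B w w) • w) = 0
      rw [map_sub, map_smul, (LinearMap.BilinForm.mem_orthogonal_iff.1 hm₁o) n hn, hB n w,
        ((hmemW' n).1 hn).2, smul_zero, sub_zero]
    rw [sub_eq_zero] at hm₁'
    rw [hm₁', map_smul, hg'w]
  -- induction hypothesis for `W'` and `g'`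
  have hIH := ih (Module.finrank K W') hlt W' rfl hW'disj g' hg'iso hg'W'
  have hmono : Submonoid.closure {r : V ≃ₗ[K] V | ∃ (u : V) (hu : B u u ≠ 0), u ∈ W' ∧
      r = Module.reflection (reflCoeff_apply_self B hu)} ≤ Submonoid.closure R :=
    Submonoid.closure_mono fun r ⟨u, hu, huW', hr⟩ => ⟨u, hu, hW'W huW', hr⟩
  obtain ⟨r', hr'mem, hr'⟩ := hrinv
  have hg_eq : g = r' * g' := by rw [hg', ← mul_assoc, hr', one_mul]
  rw [hg_eq]
  exact Submonoid.mul_mem _ hr'mem (hmono hIH)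

/-! ### The determinant of a reflection -/

/-- **A reflection has determinant `-1`** (any `f`, `x` with `f x = 2`, `V` finite-dimensional):
`s = 1 - f ⊗ x`, and by the matrix determinant lemma `det (1 - x fᵀ) = 1 - f(x) = -1`. [folklore] -/
theorem det_reflection_eq_neg_one [FiniteDimensional K V] {f : Module.Dual K V} {x : V}
    (h : f x = 2) : LinearMap.det (Module.reflection h : V →ₗ[K] V) = -1 := by
  classical
  set b := Module.finBasis K V with hb
  have hmat : LinearMap.toMatrix b b (Module.reflection h : V →ₗ[K] V) =
      1 + Matrix.replicateCol Unit (fun i => -(b.repr x i)) * Matrix.replicateRow Unit (fun j => f (b j)) := by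
    ext i j
    rw [LinearMap.toMatrix_apply, LinearEquiv.coe_coe, Module.reflection_apply, map_sub, map_smul,
      Finsupp.sub_apply, Finsupp.smul_apply, Module.Basis.repr_self, Matrix.add_apply,
      Matrix.one_apply, ← Matrix.vecMulVec_eq (ι := Unit), Matrix.vecMulVec_apply, Finsupp.single_apply, smul_eq_mul]
    by_cases hij : j = i
    · subst hij; simp; ring
    · rw [if_neg hij, if_neg (Ne.symm hij)]; ring
  rw [← LinearMap.det_toMatrix b, hmat, Matrix.det_one_add_replicateCol_mul_replicateRow,
    dotProduct]
  simp only [mul_neg, Finset.sum_neg_distrib]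
  have hsum : ∑ i, f (b i) * b.repr x i = f x := by
    conv_rhs => rw [← b.sum_repr x]
    rw [map_sum]
    refine Finset.sum_congr rfl fun i _ => ?_
    rw [map_smul, smul_eq_mul, mul_comm]
  rw [hsum, h]
  norm_num

end ZarhinLie

end Literature.AlgebraicGeometry.Motives

end
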